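import Literature.RepresentationTheory.Semisimple.BrauerNesbitt
import Literature.RepresentationTheory.Semisimple.Multiplicity
import Literature.NumberTheory.GaloisRepresentations.ContinuousRep
import Mathlib.LinearAlgebra.Matrix.ToLin
import Mathlib.LinearAlgebra.Matrix.GeneralLinearGroup.Defs
import Mathlib.LinearAlgebra.Charpoly.ToMatrix
import Mathlib.RepresentationTheory.Irreducible
import HarnessLib

/-!
# Route `PhantomRMYoshida`, crux `ResiduallyYoshidaLifting` (stmt-Langlands-13639), line `sector-klingen-split`:
# stub W `stub_innerTwistDihedral` — an inner twist of the residual Yoshida sum forces a dihedral constituent or a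
# twist pair

The registered sub-goal `stub_innerTwistDihedral` of the checked skeleton `Lines/sector_klingen_split.lean` (rev 14,
lead c5-0): for a field `k` (any characteristic), a group `Γ`, homomorphisms `σ, σ' : Γ → GL₂(k)` irreducible on `k²`
and a character `χ : Γ → kˣ` with
`det(X - σ g) · det(X - σ' g) = det(X - χ(g) σ g) · det(X - χ(g) σ' g)` for all `g` (i.e. `σ ⊕ σ'` and
`(σ ⊕ σ') ⊗ χ` have the same characteristic polynomials), EITHER `A σ A⁻¹ = χ · σ` for some `A ∈ GL₂(k)` (a dihedral
constituent) OR `A σ A⁻¹ = χ · σ'` for some `A ∈ GL₂(k)` (a twist pair).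

Proof (Brauer–Nesbitt in dimension `4`, then Schur).
* The standard representations `ρ₁, ρ₂` of `σ, σ'` on `k²` are irreducible, hence semisimple; so are their twists
  `ρᵢ ⊗ χ` (`Literature.RepresentationTheory.Semisimple.Representation.twist`, same stable subspaces) and the direct sums
  `V := ρ₁ ⊕ ρ₂`, `V_χ := (ρ₁ ⊗ χ) ⊕ (ρ₂ ⊗ χ)` (file `Multiplicity`); the characteristic polynomial of a direct sum is
  the product (Mathlib `LinearMap.charpoly_prodMap`), so the hypothesis says `det(X - V(g)) = det(X - V_χ(g))`.
* The Brauer–Nesbitt theorem over an arbitrary field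
  (`Literature.RepresentationTheory.Semisimple.Representation.nonempty_equiv_of_charpoly_eq`, Bourbaki A VIII § 20
  n° 6 Thm 2 Cor 1) gives an equivalence `V ≃ V_χ`.
* Multiplicities `[ρ : U] = dim_k Hom_Γ(U, ρ)` (file `Multiplicity`) are additive and invariant under equivalence, so
  `[ρ₁ ⊗ χ : ρ₁] + [ρ₂ ⊗ χ : ρ₁] = [V_χ : ρ₁] = [V : ρ₁] = [ρ₁ : ρ₁] + [ρ₂ : ρ₁] ≥ 1` (the identity of `ρ₁ ≠ 0`):
  there is a non-zero `Γ`-map `ρ₁ → ρᵢ ⊗ χ` for `i = 1` or `i = 2`, which is bijective by Schur (Mathlib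
  `Representation.IsIrreducible.bijective_or_eq_zero`), i.e. an equivalence `ρ₁ ≃ ρᵢ ⊗ χ`.
* The matrix `H` of such an equivalence satisfies `H σ(g) = χ(g) σᵢ(g) H`, so `A := H` conjugates `σ` to `χ · σᵢ`.

References: N. Bourbaki, *Algèbre* VIII (2012), § 20 n° 6, Thm 2, Cor 1 [BourbakiAlgebreVIII2012].  No new definitions;
helper lemmas are private.
-/

noncomputable section

-- `Summit.Langlands.Langlands.…` (summit = sub-problem name, D-0017 layout) trips `dupNamespace` on every decl;
-- project-wide option (lakefile `weak.linter.dupNamespace = false`).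
set_option linter.dupNamespace false
set_option autoImplicit false

open scoped MatrixGroups Matrix

namespace Summit.Langlands.Langlands.Cruxes.ResiduallyYoshidaLifting.SectorKlingenSplit.Fibre

open Literature.NumberTheory.GaloisRepresentations
open Literature.RepresentationTheory.Semisimple

variable {k : Type*} [Field k] {Γ : Type*} [Group Γ]

/-! ### The standard representation of a matrix representation and its twists, in coordinates -/

/-- The standard representation on `kⁿ` through `ψ : Γ → GL_n(k)`, as a linear map, is `Matrix.toLin'` of the matrix
`ψ(g)`. [folklore] -/
private theorem glStd_comp_apply_eq_toLin' {n : ℕ} (ψ : Γ →* GL (Fin n) k) (g : Γ) :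
    (((glStdRepresentation (Fin n) k).comp ψ) g : (Fin n → k) →ₗ[k] (Fin n → k)) =
      Matrix.toLin' (ψ g).val :=
  LinearMap.ext fun v ↦ by rw [Matrix.toLin'_apply]; rfl

/-- The characteristic polynomial of `g` in the standard representation of `Γ` on `kⁿ` through `ψ : Γ → GL_n(k)` is
the characteristic polynomial of the matrix `ψ(g)`. [folklore] -/
private theorem charpoly_rep_eq {n : ℕ} (ψ : Γ →* GL (Fin n) k) (g : Γ) :
    (((glStdRepresentation (Fin n) k).comp ψ) g).charpoly = (ψ g).val.charpoly := by
  rw [glStd_comp_apply_eq_toLin', Matrix.charpoly_toLin']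

/-- The characteristic polynomial of `g` in the twist by `χ` of the standard representation through `ψ` is that of
the matrix `χ(g) · ψ(g)`. [folklore] -/
private theorem charpoly_twist_rep_eq {n : ℕ} (ψ : Γ →* GL (Fin n) k) (χ : Γ →* kˣ) (g : Γ) :
    ((Representation.twist ((glStdRepresentation (Fin n) k).comp ψ) χ) g).charpoly =
      (((χ g : kˣ) : k) • (ψ g).val).charpoly := by
  rw [Representation.twist_apply, glStd_comp_apply_eq_toLin', ← LinearEquiv.map_smul, Matrix.charpoly_toLin']

/-- The matrix (standard basis) of `g` in the standard representation through `ψ` is `ψ(g)`. [folklore] -/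
private theorem toMatrix'_rep_eq {n : ℕ} (ψ : Γ →* GL (Fin n) k) (g : Γ) :
    LinearMap.toMatrix' (((glStdRepresentation (Fin n) k).comp ψ) g : (Fin n → k) →ₗ[k] (Fin n → k)) =
      (ψ g).val := by
  rw [glStd_comp_apply_eq_toLin', LinearMap.toMatrix'_toLin']

/-- The matrix (standard basis) of `g` in the twist by `χ` of the standard representation through `ψ` is
`χ(g) · ψ(g)`. [folklore] -/
private theorem toMatrix'_twist_rep_eq {n : ℕ} (ψ : Γ →* GL (Fin n) k) (χ : Γ →* kˣ) (g : Γ) :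
    LinearMap.toMatrix'
        ((Representation.twist ((glStdRepresentation (Fin n) k).comp ψ) χ) g : (Fin n → k) →ₗ[k] (Fin n → k)) =
      ((χ g : kˣ) : k) • (ψ g).val := by
  rw [Representation.twist_apply, LinearEquiv.map_smul, toMatrix'_rep_eq]

/-- An irreducible representation is semisimple (a simple bounded lattice is complemented). [folklore] -/
private theorem isSemisimple_of_isIrreducible {V : Type*} [AddCommGroup V] [Module k V]
    (ρ : Representation k Γ V) (h : ρ.IsIrreducible) : ρ.IsSemisimpleRepresentation := by
  haveI : IsSimpleOrder (Subrepresentation ρ) := h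
  exact (inferInstance : ComplementedLattice (Subrepresentation ρ))

/-- The identity of the (non-zero) standard representation on `k²` is a non-zero intertwining operator, so
`[ρ : ρ] ≥ 1`. [folklore] -/
private theorem mult_self_pos (ψ : Γ →* GL (Fin 2) k) :
    0 < Representation.mult ((glStdRepresentation (Fin 2) k).comp ψ) ((glStdRepresentation (Fin 2) k).comp ψ) := by
  rw [Representation.mult_pos_iff]
  refine ⟨Representation.IntertwiningMap.id _, fun h ↦ one_ne_zero (α := k) ?_⟩
  have h1 := congrFun (DFunLike.congr_fun h (fun _ ↦ (1 : k))) 0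
  simp at h1

/-! ### From an equivalence with a twist to a conjugating matrix -/

/-- An equivalence `ρ_σ ≃ ρ_τ ⊗ χ` between the standard representation of `σ : Γ → GL_n(k)` and the twist by `χ` of
that of `τ : Γ → GL_n(k)` is given by an invertible matrix `A` with `A σ(g) A⁻¹ = χ(g) τ(g)`. [folklore] -/
private theorem exists_conj_of_equiv_twist {n : ℕ} (σ τ : Γ →* GL (Fin n) k) (χ : Γ →* kˣ)
    (e : Representation.Equiv ((glStdRepresentation (Fin n) k).comp σ)
      (Representation.twist ((glStdRepresentation (Fin n) k).comp τ) χ)) :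
    ∃ A : GL (Fin n) k, ∀ g, (A * σ g * A⁻¹).val = ((χ g : kˣ) : k) • (τ g).val := by
  set ρ₁ : Representation k Γ (Fin n → k) := (glStdRepresentation (Fin n) k).comp σ with hρ₁
  set ρ₂ : Representation k Γ (Fin n → k) := Representation.twist ((glStdRepresentation (Fin n) k).comp τ) χ
    with hρ₂
  -- the matrix `H` of `e` and the matrix `H'` of `e⁻¹`
  set E : (Fin n → k) ≃ₗ[k] (Fin n → k) := e.toLinearEquiv with hE
  set H : Matrix (Fin n) (Fin n) k := LinearMap.toMatrix' (E : (Fin n → k) →ₗ[k] (Fin n → k)) with hH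
  set H' : Matrix (Fin n) (Fin n) k := LinearMap.toMatrix' (E.symm : (Fin n → k) →ₗ[k] (Fin n → k)) with hH'
  have hHH' : H * H' = 1 := by
    rw [hH, hH', ← LinearMap.toMatrix'_comp, LinearEquiv.comp_symm, LinearMap.toMatrix'_id]
  have hH'H : H' * H = 1 := by
    rw [hH, hH', ← LinearMap.toMatrix'_comp, LinearEquiv.symm_comp, LinearMap.toMatrix'_id]
  -- the intertwining identity in matrix form
  have hint : ∀ g, H * (σ g).val = (((χ g : kˣ) : k) • (τ g).val) * H := fun g ↦ by
    have h1 : (E : (Fin n → k) →ₗ[k] (Fin n → k)) ∘ₗ (ρ₁ g) = (ρ₂ g) ∘ₗ (E : (Fin n → k) →ₗ[k] (Fin n → k)) :=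
      e.toIntertwiningMap.isIntertwining' g
    have h2 := congrArg LinearMap.toMatrix' h1
    rw [LinearMap.toMatrix'_comp, LinearMap.toMatrix'_comp] at h2
    rw [hρ₁, hρ₂, toMatrix'_rep_eq, toMatrix'_twist_rep_eq] at h2
    exact h2
  refine ⟨⟨H, H', hHH', hH'H⟩, fun g ↦ ?_⟩
  change H * (σ g).val * H' = ((χ g : kˣ) : k) • (τ g).val
  rw [hint g, Matrix.mul_assoc, hHH', Matrix.mul_one]

/-! ### The registered stub -/

/-- **Stub W `stub_innerTwistDihedral`.**  Let `σ̄, σ̄' : Γ → GL₂(k)` be irreducible and `χ : Γ → kˣ` a character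
such that `σ̄ ⊕ σ̄'` and `(σ̄ ⊕ σ̄') ⊗ χ` have the same characteristic polynomials (the residual shadow of an INNER TWIST
`ρ ≅ ρ ⊗ χ` of a point of the fibre).  Then EITHER `σ̄ ≅ σ̄ ⊗ χ` (a dihedral constituent) OR `σ̄' ⊗ χ ≅ σ̄` up to
`GL₂(k)`-conjugation (a twist pair).  Why: the two `4`-dimensional sums are semisimple with equal characteristic
polynomials, so Brauer–Nesbitt over any field (`Representation.nonempty_equiv_of_charpoly_eq`) makes them equivalent;
counting multiplicities `[· : σ̄] = dim Hom_Γ(σ̄, ·)` (additive, equivalence-invariant, `[σ̄ : σ̄] ≥ 1`) gives a non-zero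
`Γ`-map `σ̄ → σ̄ ⊗ χ` or `σ̄ → σ̄' ⊗ χ`, bijective by Schur, and the matrix of such an equivalence conjugates.
[cite: BourbakiAlgebreVIII2012, VIII § 20 n° 6, Thm. 2, Cor. 1 (p. 378)] -/
theorem stub_innerTwistDihedral :
    ∀ (k : Type) [Field k] (Γ : Type) [Group Γ] (σ σ' : Γ →* GL (Fin 2) k) (χ : Γ →* kˣ),
      Representation.IsIrreducible ((glStdRepresentation (Fin 2) k).comp σ) →
      Representation.IsIrreducible ((glStdRepresentation (Fin 2) k).comp σ') →
      (∀ g, (σ g).val.charpoly * (σ' g).val.charpoly =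
        (((χ g : kˣ) : k) • (σ g).val).charpoly * (((χ g : kˣ) : k) • (σ' g).val).charpoly) →
      (∃ A : GL (Fin 2) k, ∀ g, (A * σ g * A⁻¹).val = ((χ g : kˣ) : k) • (σ g).val) ∨
      (∃ A : GL (Fin 2) k, ∀ g, (A * σ g * A⁻¹).val = ((χ g : kˣ) : k) • (σ' g).val) := by
  intro k _ Γ _ σ σ' χ hσ hσ' hcp
  set ρ₁ : Representation k Γ (Fin 2 → k) := (glStdRepresentation (Fin 2) k).comp σ with hρ₁
  set ρ₂ : Representation k Γ (Fin 2 → k) := (glStdRepresentation (Fin 2) k).comp σ' with hρ₂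
  haveI : ρ₁.IsIrreducible := hσ
  haveI : ρ₂.IsIrreducible := hσ'
  haveI : ρ₁.IsSemisimpleRepresentation := isSemisimple_of_isIrreducible ρ₁ hσ
  haveI : ρ₂.IsSemisimpleRepresentation := isSemisimple_of_isIrreducible ρ₂ hσ'
  -- the two semisimple `4`-dimensional representations `ρ₁ ⊕ ρ₂` and `(ρ₁ ⊗ χ) ⊕ (ρ₂ ⊗ χ)` have equal characteristic
  -- polynomials
  have hcpV : ∀ g, ((ρ₁.prod ρ₂) g).charpoly =
      (((Representation.twist ρ₁ χ).prod (Representation.twist ρ₂ χ)) g).charpoly := fun g ↦ by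
    rw [show (ρ₁.prod ρ₂) g = (ρ₁ g).prodMap (ρ₂ g) from rfl,
      show ((Representation.twist ρ₁ χ).prod (Representation.twist ρ₂ χ)) g =
        ((Representation.twist ρ₁ χ) g).prodMap ((Representation.twist ρ₂ χ) g) from rfl,
      LinearMap.charpoly_prodMap, LinearMap.charpoly_prodMap, hρ₁, hρ₂, charpoly_rep_eq, charpoly_rep_eq,
      charpoly_twist_rep_eq, charpoly_twist_rep_eq]
    exact hcp g
  -- Brauer–Nesbitt: they are equivalent
  obtain ⟨e⟩ := Representation.nonempty_equiv_of_charpoly_eq (ρ₁.prod ρ₂)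
    ((Representation.twist ρ₁ χ).prod (Representation.twist ρ₂ χ)) hcpV
  -- multiplicities of `ρ₁`
  have hmult : Representation.mult ρ₁ ρ₁ + Representation.mult ρ₁ ρ₂ =
      Representation.mult ρ₁ (Representation.twist ρ₁ χ) + Representation.mult ρ₁ (Representation.twist ρ₂ χ) := by
    rw [← Representation.mult_prod, ← Representation.mult_prod]
    exact Representation.mult_congr_right ρ₁ e
  have h1 : 0 < Representation.mult ρ₁ ρ₁ := by
    rw [hρ₁]
    exact mult_self_pos σ
  rcases (Representation.mult ρ₁ (Representation.twist ρ₁ χ)).eq_zero_or_pos with h0 | h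
  · -- `Hom_Γ(ρ₁, ρ₂ ⊗ χ) ≠ 0`: a twist pair
    right
    have h' : 0 < Representation.mult ρ₁ (Representation.twist ρ₂ χ) := by omega
    obtain ⟨f, hf⟩ := (Representation.mult_pos_iff _ _).mp h'
    have hbij := (Representation.IsIrreducible.bijective_or_eq_zero f).resolve_right hf
    exact exists_conj_of_equiv_twist σ σ' χ (f.ofBijective hbij)
  · -- `Hom_Γ(ρ₁, ρ₁ ⊗ χ) ≠ 0`: a dihedral constituent
    left
    obtain ⟨f, hf⟩ := (Representation.mult_pos_iff _ _).mp h
    have hbij := (Representation.IsIrreducible.bijective_or_eq_zero f).resolve_right hf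
    exact exists_conj_of_equiv_twist σ σ χ (f.ofBijective hbij)

end Summit.Langlands.Langlands.Cruxes.ResiduallyYoshidaLifting.SectorKlingenSplit.Fibre

end
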